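import Mathlib
import Literature.Computability.Complexity.CNF
import Summits.PneNP.PneNP.Theorems.OverlapGapAlgebraSolvableImpliesStableSectionEngine
import Summits.PneNP.PneNP.Theorems.OverlapGapAlgebraSolvableImpliesStableSectionLipschitzTransferBoost
import Summits.PneNP.PneNP.Theorems.OverlapGapAlgebraSolvableImpliesStableSectionMeanSquareTransferBoost

/-!
# PneNP / OverlapGapAlgebra — crux `SolvableImpliesStableSection` (stmt-PneNP-2463):
# the mean-square transfer, UNIFORM deterministic form (one `n`, every map, every sensitivity level)

Support for crux `stmt-PneNP-2463` (`Summit.PneNP.PneNP.Theses.OverlapGapAlgebra.SolvableImpliesStableSection`).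
The asymptotic transfers `sissMS_…` / `sissMSR_…` quantify "eventually in `n`" AFTER fixing the
sensitivity sequence `s₂`. For structural consequences about ARBITRARY solvers (file
`…SearchHardWindowInstabilityNecessary`: success in the window forces large mean-square sensitivity)
one needs the threshold in `n` to be uniform in the map and in the sensitivity level. This file isolates
the deterministic core of the proof of `sissMSR_concl_of_rateSolver`:

* `sissMSU_pathEvent` — at ONE `n` satisfying explicit largeness conditions (depending only on
  `k, α, η, ν, c` and the small constant `δ`), for EVERY level `s ≥ 0` with `s log³ n ≤ δ n` and EVERY
  map `g` with `∑_{(a,b)} ∑_{(Φ,ℓ)} d_H(g Φ, g Φ[(a,b) ↦ ℓ])² ≤ s·(m k)·#Inst·2n` satisfying at least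
  `(8k(2 + 9 s log² n)/(ν² m))·#Inst` instances of `F_k(n, m)`, `m = ⌊αn⌋₊`: the path event of the crux
  holds for `g` on at least `e^{-cn}·#paths` of the path tuples;
* `sissMSU_eventually` — the largeness conditions hold eventually in `n`.
No new definitions; axioms `propext`, `Classical.choice`, `Quot.sound`.
-/

set_option linter.dupNamespace false -- `Summit.PneNP.PneNP.…`: summit = sub-problem (D-0017)

namespace Summit.PneNP.PneNP.Theorems

open Finset Filter Asymptotics
open scoped Classical

/-- **The mean-square transfer at one `n` (deterministic, uniform in the map and the level).** See the
file header: under the explicit smallness conditions on `δ` and largeness conditions on `n ≥ 3`, every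
map `g` of mean-square single-literal-resample sensitivity `≤ s` (`0 ≤ s`, `s log³ n ≤ δ n`) that solves
at least `(8k(2 + 9 s log² n)/(ν² m))·#Inst` instances realises the path event of
`SolvableImpliesStableSection` (`νm`-valid at all splice points, `ηn`-stable between consecutive ones) on
at least `e^{-cn}·#paths` of the Bresler–Huang path tuples. -/
theorem sissMSU_pathEvent (k : ℕ) (hk : 1 ≤ k) (α η ν c δ : ℝ) (hα : 0 < α) (hη : 0 < η) (hν : 0 < ν)
    (hc : 0 < c)
    (hδa : δ ≤ 1 * ν ^ 2 * α / (144 * k)) (hδη : δ ≤ η ^ 2 / (k * α))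
    (hδc : δ ≤ c * ν ^ 2 / (576 * k ^ 3)) (hδb : δ ≤ α * ν ^ 2 / (288 * k))
    (n m : ℕ) (hn3 : 3 ≤ n)
    (hC3 : (16 * k + 1 * ν ^ 2) * 2 / (1 * ν ^ 2 * α) ≤ (n : ℝ))
    (hC4 : (1 + 64 * k ^ 3 / ν ^ 2 + 8 * k) * Real.log n ≤ c * n / 2)
    (hC5 : 2 * (32 * k ^ 3 / ν ^ 2 + 4 * k + 1 + k ^ 2) / (k ^ 2 * α) ≤ (n : ℝ))
    (hC7 : α ^ 2 * Real.exp (α * k * Real.exp 2) ≤ (n : ℝ))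
    (hC8 : α * ν ^ 2 * Real.exp (α * k * Real.exp 2) ≤ (n : ℝ))
    (hm : m = ⌊α * n⌋₊) (s : ℝ) (hs0n : 0 ≤ s) (hC1 : s * Real.log n ^ 3 ≤ δ * n)
    (g : (Fin m → Fin k → Fin n × Bool) → (Fin n → Bool))
    (hg : (∑ a : Fin m, ∑ b : Fin k, ∑ p : (Fin m → Fin k → Fin n × Bool) × (Fin n × Bool),
        (hammingDist (g p.1) (g (Function.update p.1 a (Function.update (p.1 a) b p.2))) : ℝ) ^ 2)
      ≤ s * (((m * k : ℕ) : ℝ) * (Fintype.card (Fin m → Fin k → Fin n × Bool) * (2 * n))))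
    (hsucc : 8 * k * (2 + 9 * Real.log n ^ 2 * s) / (ν ^ 2 * m)
        * Fintype.card (Fin m → Fin k → Fin n × Bool) ≤
      ((Finset.univ.filter fun Φ : Fin m → Fin k → Fin n × Bool =>
        ∀ i, ∃ j, g Φ (Φ i j).1 = (Φ i j).2).card : ℝ)) :
    Real.exp (-(c * n)) * Fintype.card (Fin (k + 1) → Fin m → Fin k → Fin n × Bool) ≤
      ((Finset.univ.filter fun Ψ : Fin (k + 1) → Fin m → Fin k → Fin n × Bool =>
        let P : Fin k → ℕ → Fin m → Fin k → Fin n × Bool :=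
          fun r q a b => if (a : ℕ) * k + b < q then Ψ r.succ a b else Ψ r.castSucc a b
        (∀ r : Fin k, ∀ q ≤ m * k, ((Finset.univ.filter fun i : Fin m =>
          ∀ j, g (P r q) (P r q i j).1 ≠ (P r q i j).2).card : ℝ) ≤ ν * m) ∧
        ∀ r : Fin k, ∀ q < m * k,
          (hammingDist (g (P r q)) (g (P r (q + 1))) : ℝ) ≤ η * n).card : ℝ) := by
  have hk0 : (0 : ℝ) < k := by exact_mod_cast hk
  -- numerics of `n` and `m`
  have hn1 : 1 ≤ n := le_trans (by norm_num) hn3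
  have hnR : (1 : ℝ) ≤ n := by exact_mod_cast hn1
  have hn3R : (3 : ℝ) ≤ n := by exact_mod_cast hn3
  have hnpos : (0 : ℝ) < n := by linarith only [hnR]
  have hxpos : (0 : ℝ) < 2 * n := by linarith only [hnR]
  have hlog2le : Real.log 2 ≤ Real.log (2 * n) := Real.log_le_log two_pos (by linarith only [hnR])
  have hlog1 : 1 ≤ Real.log n := by
    rw [← Real.log_exp 1]
    apply Real.log_le_log (Real.exp_pos 1)
    have : Real.exp 1 ≤ 3 := le_of_lt (lt_trans Real.exp_one_lt_d9 (by norm_num))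
    exact this.trans hn3R
  have hm_le : (m : ℝ) ≤ α * n := by rw [hm]; exact Nat.floor_le (by positivity)
  have hm_ge : α * n - 1 ≤ m := by
    rw [hm]; have := Nat.lt_floor_add_one (α * n); linarith only [this]
  have hC1' : s * Real.log n ^ 3 ≤ δ * n := hC1
  set N : ℝ := (Fintype.card (Fin m → Fin k → Fin n × Bool) : ℝ) with hN
  obtain ⟨hm1, hjumpB, -, ht, hMB⟩ := sissMS_numerics k hk α η ν 1 c δ (s) hα hν one_pos hc hs0n
    hδa hδη hδc hδb n m hn3 hC1' hC3 hC4 hC5 hm_ge hm_le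
  have hmR : (1 : ℝ) ≤ m := by exact_mod_cast hm1
  have hmpos : (0 : ℝ) < m := by linarith only [hmR]
  -- the success threshold `εn = 8k(2 + 9 s₂ log² n)/(ν² m)`
  obtain ⟨εn, hεn⟩ : ∃ εn : ℝ, εn = 8 * k * (2 + 9 * Real.log n ^ 2 * s) / (ν ^ 2 * m) := ⟨_, rfl⟩
  have hεpos : 0 < εn := by rw [hεn]; positivity
  have hsucc' : εn * Fintype.card (Fin m → Fin k → Fin n × Bool) ≤
      ((Finset.univ.filter fun Φ : Fin m → Fin k → Fin n × Bool =>
        ∀ i, ∃ j, g Φ (Φ i j).1 = (Φ i j).2).card : ℝ) := by rw [hεn]; exact hsucc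
  -- the degree level `L = ⌈2 log n⌉₊ ≤ 3 log n`
  set L : ℕ := ⌈2 * Real.log n⌉₊ with hL
  have hLge : 2 * Real.log n ≤ L := Nat.le_ceil _
  have hLle : (L : ℝ) ≤ 3 * Real.log n := by
    have := Nat.ceil_lt_add_one (show 0 ≤ 2 * Real.log n by positivity)
    rw [← hL] at this
    linarith only [this, hlog1]
  have hL9 : (L : ℝ) ^ 2 * s ≤ 9 * Real.log n ^ 2 * s := by
    have h1 : (L : ℝ) ^ 2 ≤ (3 * Real.log n) ^ 2 := pow_le_pow_left₀ (Nat.cast_nonneg _) hLle 2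
    have h2 : (3 * Real.log n) ^ 2 = 9 * Real.log n ^ 2 := by ring
    rw [← h2]
    exact mul_le_mul_of_nonneg_right h1 hs0n
  -- the exceptional set (maximum clause-degree `> L`) is negligible
  haveI : Nonempty (Fin n × Bool) := ⟨(⟨0, hn1⟩, true)⟩
  have hNpos : 0 < N := by rw [hN]; exact_mod_cast Fintype.card_pos
  have hBad := (sissT_bad_bounds (m := m) (k := k) (n := n) hn1 α ν hα.le hν L hm_le hLge hC7 hC8).1
  -- the loss rate `A` and the good set `G`
  obtain ⟨A, hA⟩ : ∃ A : ℝ, A = 4 * k * (k * (2 + 9 * Real.log n ^ 2 * s)) / ν ^ 2 + 1 := ⟨_, rfl⟩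
  have hA0 : 0 ≤ A := by rw [hA]; positivity
  have hA1 : 1 ≤ A := by
    rw [hA]
    have : 0 ≤ 4 * k * (k * (2 + 9 * Real.log n ^ 2 * s)) / ν ^ 2 := by positivity
    linarith only [this]
  have hν2 : 0 < ν ^ 2 := by positivity
  have hAL : 4 * k * (k * (2 + (L : ℝ) ^ 2 * s)) / ν ^ 2 ≤ A := by
    rw [hA]
    have h1 : 4 * (k : ℝ) * (k * (2 + (L : ℝ) ^ 2 * s)) ≤ 4 * k * (k * (2 + 9 * Real.log n ^ 2 * s)) := by
      apply mul_le_mul_of_nonneg_left _ (by positivity)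
      apply mul_le_mul_of_nonneg_left _ hk0.le
      linarith only [hL9]
    have h2 := div_le_div_of_nonneg_right h1 hν2.le
    linarith only [h2]
  rw [← hA] at ht hMB
  have h8BL : 8 * (k * (2 + (L : ℝ) ^ 2 * s)) ≤ εn * ν ^ 2 * m := by
    have : 8 * ((k : ℝ) * (2 + (L : ℝ) ^ 2 * s)) ≤ 8 * (k * (2 + 9 * Real.log n ^ 2 * s)) := by
      apply mul_le_mul_of_nonneg_left _ (by norm_num)
      apply mul_le_mul_of_nonneg_left _ hk0.le
      linarith only [hL9]
    have hε8 : εn * ν ^ 2 * m = 8 * (k * (2 + 9 * Real.log n ^ 2 * s)) := by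
      rw [hεn]; field_simp
    rw [hε8]; exact this
  obtain ⟨G, hGdef⟩ : ∃ G : Finset (Fin m → Fin k → Fin n × Bool),
      G = (univ : Finset (Fin m → Fin k → Fin n × Bool)).filter fun Φ =>
        ((((univ : Finset (Fin m)).filter fun i => ∀ j, g Φ (Φ i j).1 ≠ (Φ i j).2).card : ℕ) : ℝ)
          ≤ ν * m := ⟨_, rfl⟩
  have hval : ∀ Φ ∈ G, ((((univ : Finset (Fin m)).filter fun i =>
      ∀ j, g Φ (Φ i j).1 ≠ (Φ i j).2).card : ℕ) : ℝ) ≤ ν * m := fun Φ hΦ => by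
    rw [hGdef] at hΦ
    exact (Finset.mem_filter.1 hΦ).2
  have hG : ((k * m : ℕ) : ℝ) * (Gᶜ.card : ℝ) ≤ A * Fintype.card (Fin m → Fin k → Fin n × Bool) := by
    have h := sissMS_km_card_invalid_le hn1 hm1 g (s) ν εn hs0n hν hεpos L hg hBad hsucc' h8BL G
      hGdef
    exact h.trans (mul_le_mul_of_nonneg_right hAL (Nat.cast_nonneg _))
  -- jump mass by Markov on the squared sensitivity: total `≤ #Inst · 2n ≤ A · #Inst · 2n`
  have hjump : (∑ a : Fin m, ∑ b : Fin k,
      (((Finset.univ : Finset ((Fin m → Fin k → Fin n × Bool) × (Fin n × Bool))).filter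
        fun p => η * n < hammingDist (g p.1)
          (g (Function.update p.1 a (Function.update (p.1 a) b p.2)))).card : ℝ))
      ≤ A * (Fintype.card (Fin m → Fin k → Fin n × Bool) * (2 * n)) := by
    have hηn : 0 < (η * n) ^ 2 := by positivity
    have hsum : (η * n) ^ 2 * (∑ a : Fin m, ∑ b : Fin k,
        (((Finset.univ : Finset ((Fin m → Fin k → Fin n × Bool) × (Fin n × Bool))).filter
          fun p => η * n < hammingDist (g p.1)
            (g (Function.update p.1 a (Function.update (p.1 a) b p.2)))).card : ℝ))
        ≤ ∑ a : Fin m, ∑ b : Fin k, ∑ p : (Fin m → Fin k → Fin n × Bool) × (Fin n × Bool),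
          (hammingDist (g p.1) (g (Function.update p.1 a (Function.update (p.1 a) b p.2))) : ℝ) ^ 2 := by
      rw [Finset.mul_sum]
      refine Finset.sum_le_sum fun a _ => ?_
      rw [Finset.mul_sum]
      exact Finset.sum_le_sum fun b _ => sissMS_card_jump_le g (η * n) (by positivity) a b
    have hchain : (η * n) ^ 2 * (∑ a : Fin m, ∑ b : Fin k,
        (((Finset.univ : Finset ((Fin m → Fin k → Fin n × Bool) × (Fin n × Bool))).filter
          fun p => η * n < hammingDist (g p.1)
            (g (Function.update p.1 a (Function.update (p.1 a) b p.2)))).card : ℝ))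
        ≤ (η * n) ^ 2 * (A * (N * (2 * n))) := by
      calc _ ≤ s * (((m * k : ℕ) : ℝ) * (N * (2 * n))) := hsum.trans hg
        _ = (s * ((m * k : ℕ) : ℝ)) * (N * (2 * n)) := by ring
        _ ≤ (η * n) ^ 2 * (N * (2 * n)) := mul_le_mul_of_nonneg_right hjumpB (by positivity)
        _ = (η * n) ^ 2 * (1 * (N * (2 * n))) := by ring
        _ ≤ (η * n) ^ 2 * (A * (N * (2 * n))) := by
            apply mul_le_mul_of_nonneg_left _ hηn.le
            exact mul_le_mul_of_nonneg_right hA1 (by positivity)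
    have := le_of_mul_le_mul_left hchain hηn
    simpa only [hN, mul_assoc] using this
  -- the engine and the growing-loss asymptotics
  have hE := Summit.PneNP.PneNP.Cruxes.SolvableImpliesStableSection.Sketch.engine_count k m n hn1 η A
    hη.le hA0 g G hG hjump
  have hasym := sissLip_asy_pointwise (M := m * k) (k := k) (Real.exp_log hxpos) hlog2le ht hMB
  -- assembly (as in `concl_of_smoothSection`)
  have hpaths : (Fintype.card (Fin (k + 1) → Fin m → Fin k → Fin n × Bool) : ℝ) =
      (2 * n) ^ (m * k * (k + 1)) := by
    rw [Summit.PneNP.PneNP.Cruxes.SolvableImpliesStableSection.Sketch.eng_card_paths]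
    push_cast
    ring
  have hmono : ((univ : Finset (Fin (k + 1) → Fin m → Fin k → Fin n × Bool)).filter fun Ψ =>
          (∀ r : Fin k, ∀ q ≤ m * k,
            (fun (a : Fin m) (b : Fin k) =>
              if (a : ℕ) * k + b < q then Ψ r.succ a b else Ψ r.castSucc a b) ∈ G) ∧
          ∀ r : Fin k, ∀ q < m * k,
            (hammingDist
              (g fun (a : Fin m) (b : Fin k) =>
                if (a : ℕ) * k + b < q then Ψ r.succ a b else Ψ r.castSucc a b)
              (g fun (a : Fin m) (b : Fin k) =>
                if (a : ℕ) * k + b < q + 1 then Ψ r.succ a b else Ψ r.castSucc a b) : ℝ)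
              ≤ η * n).card ≤
      ((univ : Finset (Fin (k + 1) → Fin m → Fin k → Fin n × Bool)).filter fun Ψ =>
        let P : Fin k → ℕ → Fin m → Fin k → Fin n × Bool :=
          fun r q a b => if (a : ℕ) * k + b < q then Ψ r.succ a b else Ψ r.castSucc a b
        (∀ r : Fin k, ∀ q ≤ m * k, (((Finset.univ : Finset (Fin m)).filter fun i =>
          ∀ j, g (P r q) (P r q i j).1 ≠ (P r q i j).2).card : ℝ) ≤ ν * m) ∧
        ∀ r : Fin k, ∀ q < m * k,
          (hammingDist (g (P r q)) (g (P r (q + 1))) : ℝ) ≤ η * n).card := by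
    refine Finset.card_le_card fun Ψ hΨ => ?_
    simp only [Finset.mem_filter, Finset.mem_univ, true_and] at hΨ ⊢
    obtain ⟨hin, hjmp⟩ := hΨ
    exact ⟨fun r q hq => hval _ (hin r q hq), fun r q hq => hjmp r q hq⟩
  have hmono' := (Nat.cast_le (α := ℝ)).2 hmono
  rw [hpaths]
  linarith only [hasym, hE, hmono']

/-- The largeness conditions of `sissMSU_pathEvent` hold eventually in `n`. -/
theorem sissMSU_eventually (k : ℕ) (α ν c : ℝ) (hν : 0 < ν) (hc : 0 < c) :
    ∀ᶠ n : ℕ in atTop, 3 ≤ n ∧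
      (16 * k + 1 * ν ^ 2) * 2 / (1 * ν ^ 2 * α) ≤ (n : ℝ) ∧
      (1 + 64 * k ^ 3 / ν ^ 2 + 8 * k) * Real.log n ≤ c * n / 2 ∧
      2 * (32 * k ^ 3 / ν ^ 2 + 4 * k + 1 + k ^ 2) / (k ^ 2 * α) ≤ (n : ℝ) ∧
      α ^ 2 * Real.exp (α * k * Real.exp 2) ≤ (n : ℝ) ∧
      α * ν ^ 2 * Real.exp (α * k * Real.exp 2) ≤ (n : ℝ) := by
  have C0 : ∀ᶠ n : ℕ in atTop, 3 ≤ n := eventually_ge_atTop 3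
  have C3 : ∀ᶠ n : ℕ in atTop, (16 * k + 1 * ν ^ 2) * 2 / (1 * ν ^ 2 * α) ≤ (n : ℝ) :=
    tendsto_natCast_atTop_atTop.eventually_ge_atTop _
  have C4 : ∀ᶠ n : ℕ in atTop, (1 + 64 * k ^ 3 / ν ^ 2 + 8 * k) * Real.log n ≤ c * n / 2 := by
    have hlo := Real.isLittleO_log_id_atTop.comp_tendsto tendsto_natCast_atTop_atTop
    have hK : (0 : ℝ) < 1 + 64 * k ^ 3 / ν ^ 2 + 8 * k := by positivity
    have hpos : 0 < c / (2 * (1 + 64 * k ^ 3 / ν ^ 2 + 8 * k)) := by positivity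
    filter_upwards [hlo.def hpos] with n hn
    simp only [Function.comp_apply, id_eq, Real.norm_eq_abs, Nat.abs_cast] at hn
    have h1 : Real.log n ≤ c / (2 * (1 + 64 * k ^ 3 / ν ^ 2 + 8 * k)) * n := (le_abs_self _).trans hn
    calc (1 + 64 * k ^ 3 / ν ^ 2 + 8 * k) * Real.log n
        ≤ (1 + 64 * k ^ 3 / ν ^ 2 + 8 * k) * (c / (2 * (1 + 64 * k ^ 3 / ν ^ 2 + 8 * k)) * n) :=
          mul_le_mul_of_nonneg_left h1 hK.le
      _ = c * n / 2 := by field_simp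
  have C5 : ∀ᶠ n : ℕ in atTop, 2 * (32 * k ^ 3 / ν ^ 2 + 4 * k + 1 + k ^ 2) / (k ^ 2 * α) ≤ (n : ℝ) :=
    tendsto_natCast_atTop_atTop.eventually_ge_atTop _
  have C7 : ∀ᶠ n : ℕ in atTop, α ^ 2 * Real.exp (α * k * Real.exp 2) ≤ (n : ℝ) :=
    tendsto_natCast_atTop_atTop.eventually_ge_atTop _
  have C8 : ∀ᶠ n : ℕ in atTop, α * ν ^ 2 * Real.exp (α * k * Real.exp 2) ≤ (n : ℝ) :=
    tendsto_natCast_atTop_atTop.eventually_ge_atTop _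
  filter_upwards [C0, C3, C4, C5, C7, C8] with n h0 h3 h4 h5 h7 h8
  exact ⟨h0, h3, h4, h5, h7, h8⟩

end Summit.PneNP.PneNP.Theorems
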